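import Summits.ResolutionOfSingularities.ResolutionOfSingularities.Theorems.EquisingularLiftEquisingularLiftNatTowerEmbRoundThree
import Summits.ResolutionOfSingularities.ResolutionOfSingularities.Theorems.EquisingularLiftEquisingularLiftNatTowerRoundBDefs
import Summits.ResolutionOfSingularities.ResolutionOfSingularities.Theorems.EquisingularLiftEquisingularLiftNatTowerBTransportFour
import HarnessLib

/-!
# [OURS · L1 W4.5(b) · EL♮(3) · T23-A‴] core‴ — THE PAIR / FIBRE-PAIR ROUND ON `Tower.InvB₄` = `Tower.invB_pairRoundCore` (p615801, res-L1-w45b-stub-4)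
# with `hfull : TowerFull …` DELETED (every member is MODEL-CARRYING, `Tower.Exc₄`: the two `not_towerFull_of_noRound` dismissals disappear) + the model-less list `Ns`

res-L1-w45b-stub-2 g13 (desk res-L1-w45b-plan-1 g20 BOOK 2026-08-28T10:16Z «core‴ (U3) the hour (U1) lands»; engine word res-L1-w45b-stub-4 v1 DRAFT
3dcf936910c4d869 §3 (U3); (U1) = `…NatTowerInvBFourDefs` p624526; transport layer = `…NatTowerBTransportFour` p625145).
Crux EL♮(3) = stmt-ResolutionOfSingularities-20148 (parent EL♮ stmt-…-20038; node stmt-…-15660), route `EquisingularLift`, line `sections`. OURS; NOT a statement of any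
manuscript; AI-written, weaker than expert review. DEF-FREE; no `sorry`; standard axioms. `--supports stmt-ResolutionOfSingularities-20148 --as helper`.

WHAT. `Tower.invB₄_pairRoundCore` = the PAIR round (centre `Z = H ∩ W`, `ConeWitness`, upstairs centre `𝓗 ⊔ 𝓦`, clauses = the explicit-stage hypothesis `hPair`) with
host `hExcH : Tower.Exc₄ …` and candidates at `Exc₄` — NO `TowerFull` (its only use in p615801 was to exclude `NoRound` host / witness); A‴'s fibre-pair round is this
theorem with a centre over a POINT of the carrier. Members `F' ∈ Es'` by `F = H ∨ F = W ∨ Disjoint Z F ∨ X3 F` through `Tower.exc₄_transport_away` /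
`Tower.exc₄_transport_transversal'`; model-less `Ns'` = topological transports of closed `F ∈ Ns ∪ (H :: Cs)` (`Tower.ns_transport_of_closed`); output `Tower.InvB₄ …
E' Es' Ns' K'`. Body = p615801 VERBATIM otherwise. [cite: GortzWedhorn2020, (13.19) and Prop. 13.91] [cite: Liu2002, Thm. 8.1.19] [cite: Matsumura1987, §16] (index only).
-/

set_option linter.dupNamespace false -- mandated namespace `Summit.<Summit>.<Problem>` of this single-conjunct summit
noncomputable section
open CategoryTheory CategoryTheory.Limits AlgebraicGeometry TopologicalSpace Topology IsLocalRing
open Literature.AlgebraicGeometry.Resolution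
open AlgebraicGeometry.Scheme.IdealSheafData
open Summit.ResolutionOfSingularities.ResolutionOfSingularities.Theses.EquisingularLift.Split
open Summit.ResolutionOfSingularities.ResolutionOfSingularities.Cruxes.EquisingularLift.StrataSplit
open scoped nonZeroDivisors
namespace Summit.ResolutionOfSingularities.ResolutionOfSingularities.Cruxes.EquisingularLiftNat.Sections

set_option maxHeartbeats 800000 in -- one large assembly over a 20-clause invariant (as in the ₆ files)
/-- **core‴ — the boundary-witnessed (PAIR / FIBRE-PAIR) round on `Tower.InvB₄`** (every member model-carrying; NO `TowerFull`), host-parametrised, at ONE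
explicit new stage: `Tower.invB_pairRoundCore` (p615801) minus the two `not_towerFull_of_noRound` lines, plus the model-less list `Ns` (module docstring).
[cite: GortzWedhorn2020, (13.19) and Prop. 13.91] [cite: Liu2002, Thm. 8.1.19] [cite: Matsumura1987, §16] [OURS · L1 W4.5b · T23-A‴ engine] clause (round, pair /
fibre pair) of the B‴-driver; toward `stub_elnat_defTowerBTriplePrimePointResolutionThree` (stmt-ResolutionOfSingularities-20148 / -20038); NOT a statement of the manuscript. -/
theorem Tower.invB₄_pairRoundCore (O : Type) [CommRing O] [IsDomain O] [IsDiscreteValuationRing O] (k : Type) [Field k]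
    (θ : O →+* k) (hθ : Function.Surjective θ)
    (P : Scheme.{0}) (q : P ⟶ Spec (.of O)) [IsProper q] (Y : Set P) (hYirr : IsIrreducible Y) (hYcl : IsClosed Y)
    (hPnoeth : IsLocallyNoetherian P) (hPreg : Scheme.IsRegular P)
    (Ch : ∀ X' : Scheme.{0}, (X' ⟶ P) → Set X' → Prop)
    (hChain : ∀ (X' : Scheme.{0}) (σ : X' ⟶ P) (S : Set X'), Ch X' σ S → Chain P Y X' σ S)
    (hStep : ∀ (X' X'' : Scheme.{0}) (σ' : X' ⟶ P) (S' : Set X') (C : X'.IdealSheafData) (τ : X'' ⟶ X'),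
      Ch X' σ' S' → IsBlowup τ C → Scheme.IsRegular C.subscheme → Flat (C.subschemeι ≫ σ' ≫ q) →
      σ' '' (C.support : Set X') ⊆ {x : P | ¬ IsGenericPoint x Y} →
      (C.support : Set X') ∩ (σ' ≫ q) ⁻¹' {IsLocalRing.closedPoint O} ⊆ S' →
      Ch X'' (τ ≫ σ') (closure (τ ⁻¹' (S' \ (C.support : Set X')))))
    (Ruled : Tower.RuledDatum P)
    {F₉ : Scheme.{0}} (Z₉ : Set F₉) (hZ₉ : IsClosed Z₉) {F₁₀ : Scheme.{0}} (υ' : F₁₀ ⟶ F₉)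
    -- an ISO-INVARIANT ruled datum (general form: any ideal on the new stage isomorphic to the old one over `τ₀`)
    (hRuledIso : ∀ (G₀ G₀' : Scheme.{0}) (γ₀ : G₀ ⟶ F₁₀) (γ₀' : G₀' ⟶ F₁₀) (E₀ : Set G₀) (E₀' : Set G₀') (X₀ X₀'' : Scheme.{0})
        (σ₀ : X₀ ⟶ P) (j₀ : G₀ ⟶ X₀) (j₀' : G₀' ⟶ X₀'') (𝓔₀ : X₀.IdealSheafData) (𝓔₀' : X₀''.IdealSheafData) (τ₀ : X₀'' ⟶ X₀),
      (∃ e : 𝓔₀'.subscheme ≅ 𝓔₀.subscheme, e.hom ≫ 𝓔₀.subschemeι = 𝓔₀'.subschemeι ≫ τ₀) →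
      Ruled F₉ Z₉ hZ₉ F₁₀ υ' G₀ γ₀ E₀ X₀ σ₀ j₀ 𝓔₀ → Ruled F₉ Z₉ hZ₉ F₁₀ υ' G₀' γ₀' E₀' X₀'' (τ₀ ≫ σ₀) j₀' 𝓔₀')
    -- T23-A′: the ruled datum follows STRICT TRANSFORMS under blow-ups (at the engine's `FE` = stub-2's `flat_strictTransform_subschemeι_comp`)
    (hRuledSt : ∀ (G₀ G₀' : Scheme.{0}) (γ₀ : G₀ ⟶ F₁₀) (γ₀' : G₀' ⟶ F₁₀) (E₀ : Set G₀) (E₀' : Set G₀') (X₀ X₀'' : Scheme.{0})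
        (σ₀ : X₀ ⟶ P) (j₀ : G₀ ⟶ X₀) (j₀' : G₀' ⟶ X₀'') (𝓔₀ C₀ : X₀.IdealSheafData) (τ₀ : X₀'' ⟶ X₀),
      IsBlowup τ₀ C₀ → IsLocallyNoetherian X₀ → IsLocallyNoetherian X₀'' →
      Ruled F₉ Z₉ hZ₉ F₁₀ υ' G₀ γ₀ E₀ X₀ σ₀ j₀ 𝓔₀ →
      Ruled F₉ Z₉ hZ₉ F₁₀ υ' G₀' γ₀' E₀' X₀'' (τ₀ ≫ σ₀) j₀' (strictTransformIdeal τ₀ C₀ 𝓔₀))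
    (G G' : Scheme.{0}) (γ : G ⟶ F₁₀) (T H KH : Set G) (Cs : List (Set G)) (hH : IsClosed H) (Z : Set G) (hZ : IsClosed Z)
    (υ₂ : G' ⟶ G)
    -- the old invariant, UNPACKED at its stage, with the host's datum and the shadow-forgotten candidates
    (hυ' : IsBlowup υ' (vanishingIdeal (⟨Z₉, hZ₉⟩ : Closeds F₉))) (hZinf : Z₉.Infinite) [IsIntegral G]
    (hTirr : IsIrreducible T) (hTH : ¬ T ⊆ H)
    (X : Scheme.{0}) (σ : X ⟶ P) (S : Set X) (jG : G ⟶ X) (tG : G ⟶ Spec (.of k))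
    (hCh : Ch X σ S) [IsIntegral X] [IsLocallyNoetherian X] (hXreg : Scheme.IsRegular X) (hdom : IsDominant (σ ≫ q))
    (hsq : IsPullback jG tG (σ ≫ q) (Spec.map (CommRingCat.ofHom θ))) (hTS : jG '' T = S)
    (hExcH : Tower.Exc₄ O P q Y Ruled Z₉ hZ₉ υ' G γ H hH KH X σ jG)
    (hCand : ∀ F ∈ Cs, ∃ hF : IsClosed F, ¬ T ⊆ F ∧ Tower.Exc₄ O P q Y Ruled Z₉ hZ₉ υ' G γ F hF ∅ X σ jG)
    -- the model-less retained list (topology only)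
    (Ns : List (Set G)) (hNs : ∀ F ∈ Ns, IsClosed F ∧ ¬ T ⊆ F)
    -- the round: a PAIR round, centre `Z = H ∩ W` witnessed by the member `W ∈ Cs` (downstairs `ConeWitness G H hH W Z hZ`, `W` closed)
    (W : Set G) (hW : IsClosed W) (hWmem : W ∈ Cs) (hpair : ConeWitness G H hH W Z hZ)
    (hZT : Z ⊆ T)
    (hυ₂ : IsBlowup υ₂ (vanishingIdeal ⟨Z, hZ⟩))
    (hKcl : IsClosed KH) (hKE : KH ⊆ closure (KH \ H)) (hKne : KH ≠ Set.univ)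
    -- THE CENTRE `𝒞 = 𝓗 ⊔ 𝓦` — its clauses AT THIS STAGE for the host's model `𝓔` and the witness's model `𝓦` (engine word 16d03a46d50c8ccd §2/§3:
    -- discharged at `FE` by (A″-0)/(A″-3) p614385, (A″-1)/(A″-2) v2 with the codimension binder at closed crossing points, and the tree's frame/Cartier bricks)
    (hPair : ∀ (𝓔 𝓦 : X.IdealSheafData),
        𝓔.comap jG = vanishingIdeal ⟨H, hH⟩ → (∀ z : X, (stalkIdeal 𝓔 z).IsPrincipal) → Scheme.IsRegular 𝓔.subscheme →
        σ '' (𝓔.support : Set X) ⊆ {p : P | ¬ IsGenericPoint p Y} → Ruled F₉ Z₉ hZ₉ F₁₀ υ' G γ H X σ jG 𝓔 →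
        𝓦.comap jG = vanishingIdeal ⟨W, hW⟩ → (∀ z : X, (stalkIdeal 𝓦 z).IsPrincipal) → Scheme.IsRegular 𝓦.subscheme →
        σ '' (𝓦.support : Set X) ⊆ {p : P | ¬ IsGenericPoint p Y} → Ruled F₉ Z₉ hZ₉ F₁₀ υ' G γ W X σ jG 𝓦 → ¬ T ⊆ W →
        (𝓔 ⊔ 𝓦).comap jG = vanishingIdeal ⟨Z, hZ⟩ ∧ Flat ((𝓔 ⊔ 𝓦).subschemeι ≫ σ ≫ q) ∧
          Scheme.IsRegular (𝓔 ⊔ 𝓦).subscheme ∧ IsEffectiveCartier (𝓦.comap 𝓔.subschemeι) ∧ IsEffectiveCartier (𝓔.comap 𝓦.subschemeι) ∧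
          (∀ x ∈ (𝓔 ⊔ 𝓦).support, ∃ c : Fin 2 → X.presheaf.stalk x,
            Ideal.span (Set.range c) = stalkIdeal (𝓔 ⊔ 𝓦) x ∧ IsQuasiRegular c))
    -- (N3) the transported shadow next to the NEW surface (stub-2's `hShadow` verbatim, `E ↦ H`, `K ↦ KH`)
    (hShadow : ∀ (X : Scheme.{0}) (σ : X ⟶ P) (S : Set X) (jG : G ⟶ X) (tG : G ⟶ Spec (.of k)) (𝓔 𝒦 𝒦₁ : X.IdealSheafData)
        (X₂ : Scheme.{0}) (τ : X₂ ⟶ X) (j₂ : G' ⟶ X₂) (t₂ : G' ⟶ Spec (.of k)),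
        Ch X σ S → IsIntegral X → IsLocallyNoetherian X → Scheme.IsRegular X → IsDominant (σ ≫ q) →
        IsPullback jG tG (σ ≫ q) (Spec.map (CommRingCat.ofHom θ)) → jG '' T = S →
        𝓔.comap jG = vanishingIdeal ⟨H, hH⟩ → (∀ z : X, (stalkIdeal 𝓔 z).IsPrincipal) → Scheme.IsRegular 𝓔.subscheme →
        (∀ z : X, (stalkIdeal 𝒦 z).IsPrincipal) → ∀ (V : G.Opens), H ⊆ (V : Set G) →
        (𝒦.comap jG).comap V.ι = (vanishingIdeal (⟨closure KH, isClosed_closure⟩ : Closeds G)).comap V.ι →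
        Flat ((𝓔 ⊔ 𝒦).subschemeι ≫ σ ≫ q) → IsEffectiveCartier (𝓔.comap 𝒦.subschemeι) → IsEffectiveCartier (𝒦.comap 𝓔.subschemeι) →
        (𝓔 ⊔ 𝒦₁).comap jG = vanishingIdeal ⟨Z, hZ⟩ → Flat ((𝓔 ⊔ 𝒦₁).subschemeι ≫ σ ≫ q) → Scheme.IsRegular (𝓔 ⊔ 𝒦₁).subscheme →
        IsEffectiveCartier (𝒦₁.comap 𝓔.subschemeι) →
        IsBlowup τ (𝓔 ⊔ 𝒦₁) → IsPullback j₂ t₂ ((τ ≫ σ) ≫ q) (Spec.map (CommRingCat.ofHom θ)) → j₂ ≫ τ = υ₂ ≫ jG →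
        IsClosed KH → KH ⊆ closure (KH \ H) → KH ≠ Set.univ → closure (Z \ closure KH) = Z →
        ((strictTransformIdeal τ (𝓔 ⊔ 𝒦₁) 𝒦).comap j₂).comap (υ₂ ⁻¹ᵁ V).ι =
            (vanishingIdeal (⟨closure (closure (υ₂ ⁻¹' (KH \ Z))), isClosed_closure⟩ : Closeds G')).comap (υ₂ ⁻¹ᵁ V).ι ∧
          Flat ((((𝓔 ⊔ 𝒦₁).comap τ) ⊔ strictTransformIdeal τ (𝓔 ⊔ 𝒦₁) 𝒦).subschemeι ≫ (τ ≫ σ) ≫ q) ∧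
          (∀ (hE' : IsClosed (υ₂ ⁻¹' Z)) (y : G'),
            j₂ y ∈ ((((𝓔 ⊔ 𝒦₁).comap τ) ⊔ strictTransformIdeal τ (𝓔 ⊔ 𝒦₁) 𝒦).support : Set X₂) →
            stalkIdeal (vanishingIdeal (⟨υ₂ ⁻¹' Z, hE'⟩ : Closeds G') ⊔
              vanishingIdeal (⟨closure (closure (υ₂ ⁻¹' (KH \ Z))), isClosed_closure⟩ : Closeds G')) y =
            stalkIdeal (vanishingIdeal (⟨υ₂ ⁻¹' Z ∩ closure (closure (υ₂ ⁻¹' (KH \ Z))), hE'.inter isClosed_closure⟩ : Closeds G')) y →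
            IsRegularLocalRing (X₂.presheaf.stalk (j₂ y) ⧸
              stalkIdeal (((𝓔 ⊔ 𝒦₁).comap τ) ⊔ strictTransformIdeal τ (𝓔 ⊔ 𝒦₁) 𝒦) (j₂ y))) ∧
          IsEffectiveCartier (((𝓔 ⊔ 𝒦₁).comap τ).comap (strictTransformIdeal τ (𝓔 ⊔ 𝒦₁) 𝒦).subschemeι) ∧
          IsEffectiveCartier ((strictTransformIdeal τ (𝓔 ⊔ 𝒦₁) 𝒦).comap ((𝓔 ⊔ 𝒦₁).comap τ).subschemeι))
    -- (N3′) the transported shadow next to the OLD surface (stub-2's `hShadowOld` verbatim, `E ↦ H`, `K ↦ KH`)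
    (hShadowOld : ∀ (X : Scheme.{0}) (σ : X ⟶ P) (S : Set X) (jG : G ⟶ X) (tG : G ⟶ Spec (.of k)) (𝓔 𝒦 𝒦₁ : X.IdealSheafData)
        (X₂ : Scheme.{0}) (τ : X₂ ⟶ X) (j₂ : G' ⟶ X₂) (t₂ : G' ⟶ Spec (.of k)),
        Ch X σ S → IsIntegral X → IsLocallyNoetherian X → Scheme.IsRegular X → IsDominant (σ ≫ q) →
        IsPullback jG tG (σ ≫ q) (Spec.map (CommRingCat.ofHom θ)) → jG '' T = S →
        𝓔.comap jG = vanishingIdeal ⟨H, hH⟩ → (∀ z : X, (stalkIdeal 𝓔 z).IsPrincipal) → Scheme.IsRegular 𝓔.subscheme →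
        (∀ z : X, (stalkIdeal 𝒦 z).IsPrincipal) → ∀ (V : G.Opens), H ⊆ (V : Set G) →
        (𝒦.comap jG).comap V.ι = (vanishingIdeal (⟨closure KH, isClosed_closure⟩ : Closeds G)).comap V.ι →
        Flat ((𝓔 ⊔ 𝒦).subschemeι ≫ σ ≫ q) →
        (∀ y : G, jG y ∈ ((𝓔 ⊔ 𝒦).support : Set X) →
          stalkIdeal (vanishingIdeal (⟨H, hH⟩ : Closeds G) ⊔ vanishingIdeal (⟨closure KH, isClosed_closure⟩ : Closeds G)) y =
            stalkIdeal (vanishingIdeal (⟨H ∩ closure KH, hH.inter isClosed_closure⟩ : Closeds G)) y →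
          IsRegularLocalRing (X.presheaf.stalk (jG y) ⧸ stalkIdeal (𝓔 ⊔ 𝒦) (jG y))) →
        IsEffectiveCartier (𝓔.comap 𝒦.subschemeι) → IsEffectiveCartier (𝒦.comap 𝓔.subschemeι) →
        (𝓔 ⊔ 𝒦₁).comap jG = vanishingIdeal ⟨Z, hZ⟩ → Flat ((𝓔 ⊔ 𝒦₁).subschemeι ≫ σ ≫ q) → Scheme.IsRegular (𝓔 ⊔ 𝒦₁).subscheme →
        IsEffectiveCartier (𝒦₁.comap 𝓔.subschemeι) →
        IsBlowup τ (𝓔 ⊔ 𝒦₁) → IsPullback j₂ t₂ ((τ ≫ σ) ≫ q) (Spec.map (CommRingCat.ofHom θ)) → j₂ ≫ τ = υ₂ ≫ jG →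
        IsClosed KH → KH ⊆ closure (KH \ H) → KH ≠ Set.univ → closure (Z \ closure KH) = Z →
        ((strictTransformIdeal τ (𝓔 ⊔ 𝒦₁) 𝒦).comap j₂).comap (υ₂ ⁻¹ᵁ V).ι =
            (vanishingIdeal (⟨closure (closure (υ₂ ⁻¹' (KH \ Z))), isClosed_closure⟩ : Closeds G')).comap (υ₂ ⁻¹ᵁ V).ι ∧
          Flat ((strictTransformIdeal τ (𝓔 ⊔ 𝒦₁) 𝓔 ⊔ strictTransformIdeal τ (𝓔 ⊔ 𝒦₁) 𝒦).subschemeι ≫ (τ ≫ σ) ≫ q) ∧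
          (∀ (hE' : IsClosed (closure (υ₂ ⁻¹' (H \ Z)))) (y : G'),
            j₂ y ∈ ((strictTransformIdeal τ (𝓔 ⊔ 𝒦₁) 𝓔 ⊔ strictTransformIdeal τ (𝓔 ⊔ 𝒦₁) 𝒦).support : Set X₂) →
            stalkIdeal (vanishingIdeal (⟨closure (υ₂ ⁻¹' (H \ Z)), hE'⟩ : Closeds G') ⊔
              vanishingIdeal (⟨closure (closure (υ₂ ⁻¹' (KH \ Z))), isClosed_closure⟩ : Closeds G')) y =
            stalkIdeal (vanishingIdeal (⟨closure (υ₂ ⁻¹' (H \ Z)) ∩ closure (closure (υ₂ ⁻¹' (KH \ Z))), hE'.inter isClosed_closure⟩ :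
              Closeds G')) y →
            IsRegularLocalRing (X₂.presheaf.stalk (j₂ y) ⧸
              stalkIdeal (strictTransformIdeal τ (𝓔 ⊔ 𝒦₁) 𝓔 ⊔ strictTransformIdeal τ (𝓔 ⊔ 𝒦₁) 𝒦) (j₂ y))) ∧
          IsEffectiveCartier ((strictTransformIdeal τ (𝓔 ⊔ 𝒦₁) 𝓔).comap (strictTransformIdeal τ (𝓔 ⊔ 𝒦₁) 𝒦).subschemeι) ∧
          IsEffectiveCartier ((strictTransformIdeal τ (𝓔 ⊔ 𝒦₁) 𝒦).comap (strictTransformIdeal τ (𝓔 ⊔ 𝒦₁) 𝓔).subschemeι))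
    -- BIRTH of the datum for the NEW surface (stub-2's `hRuled` of `_new` verbatim, `E ↦ H`)
    (hRuledBorn : ∀ (X : Scheme.{0}) (σ : X ⟶ P) (S : Set X) (jG : G ⟶ X) (tG : G ⟶ Spec (.of k)) (𝓔 𝒦₁ : X.IdealSheafData)
        (X'' : Scheme.{0}) (τ : X'' ⟶ X) (j₂ : G' ⟶ X'') (t₂ : G' ⟶ Spec (.of k)),
        Ch X σ S → IsIntegral X → IsLocallyNoetherian X → Scheme.IsRegular X → IsDominant (σ ≫ q) →
        IsPullback jG tG (σ ≫ q) (Spec.map (CommRingCat.ofHom θ)) → jG '' T = S →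
        (𝓔 ⊔ 𝒦₁).comap jG = vanishingIdeal ⟨Z, hZ⟩ → Flat ((𝓔 ⊔ 𝒦₁).subschemeι ≫ σ ≫ q) → Scheme.IsRegular (𝓔 ⊔ 𝒦₁).subscheme →
        Scheme.IsRegular 𝓔.subscheme → IsBlowup τ (𝓔 ⊔ 𝒦₁) → IsPullback j₂ t₂ ((τ ≫ σ) ≫ q) (Spec.map (CommRingCat.ofHom θ)) →
        j₂ ≫ τ = υ₂ ≫ jG →
        Ruled F₉ Z₉ hZ₉ F₁₀ υ' G' (υ₂ ≫ γ) (υ₂ ⁻¹' Z) X'' (τ ≫ σ) j₂ ((𝓔 ⊔ 𝒦₁).comap τ))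
    -- T23-A′: the downstairs THIRD transport alternative `X3 F` (text owner's choice, e.g. the stalkwise (T1) ∧ (T2) of SIG v2 767f3543c2b2e4ae)
    -- and its two upstairs dischargers at THIS stage: (A′-1) snc of the member's model with the centre, (A′-3) the special-fibre trace
    (X3 : Set G → Prop)
    (hSNC : ∀ (C 𝓕 : X.IdealSheafData) (F : Set G) (hF : IsClosed F), X3 F → IsProper (σ ≫ q) →
      C.comap jG = vanishingIdeal ⟨Z, hZ⟩ → Flat (C.subschemeι ≫ σ ≫ q) → Scheme.IsRegular C.subscheme →
      𝓕.comap jG = vanishingIdeal ⟨F, hF⟩ → (∀ z : X, (stalkIdeal 𝓕 z).IsPrincipal) → Scheme.IsRegular 𝓕.subscheme →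
      σ '' (𝓕.support : Set X) ⊆ {p : P | ¬ IsGenericPoint p Y} → Ruled F₉ Z₉ hZ₉ F₁₀ υ' G γ F X σ jG 𝓕 → ¬ T ⊆ F →
      HasSNCWith [𝓕] C)
    (hTrace : ∀ (C 𝓕 : X.IdealSheafData) (F : Set G) (hF : IsClosed F) (X₂ : Scheme.{0}) (τ : X₂ ⟶ X) (j₂ : G' ⟶ X₂)
        (t₂ : G' ⟶ Spec (.of k)), X3 F → IsProper (σ ≫ q) →
      C.comap jG = vanishingIdeal ⟨Z, hZ⟩ → Flat (C.subschemeι ≫ σ ≫ q) → Scheme.IsRegular C.subscheme →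
      IsBlowup τ C → IsLocallyNoetherian X₂ → IsPullback j₂ t₂ ((τ ≫ σ) ≫ q) (Spec.map (CommRingCat.ofHom θ)) → j₂ ≫ τ = υ₂ ≫ jG →
      𝓕.comap jG = vanishingIdeal ⟨F, hF⟩ → (∀ z : X, (stalkIdeal 𝓕 z).IsPrincipal) → Scheme.IsRegular 𝓕.subscheme →
      σ '' (𝓕.support : Set X) ⊆ {p : P | ¬ IsGenericPoint p Y} → Ruled F₉ Z₉ hZ₉ F₁₀ υ' G γ F X σ jG 𝓕 → ¬ T ⊆ F →
      HasSNCWith [𝓕] C →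
      (strictTransformIdeal τ C 𝓕).comap j₂ = vanishingIdeal (⟨closure (υ₂ ⁻¹' (F \ Z)), isClosed_closure⟩ : Closeds G'))
    -- the producer's menus: shadow (₅, off the shadow — the cone-witnessed alternative goes to the cone twin), running surface, retained list
    (K' E' : Set G') (Es' Ns' : List (Set G'))
    (hK' : K' = ∅ ∨ (closure (Z \ closure KH) = Z ∧ K' = closure (υ₂ ⁻¹' (KH \ Z))))
    (hE' : E' = υ₂ ⁻¹' Z ∨ E' = closure (υ₂ ⁻¹' (H \ Z)))
    (hEs' : ∀ F' ∈ Es', ∃ F ∈ Cs, (F = H ∨ F = W ∨ Disjoint Z F ∨ X3 F) ∧ F' = closure (υ₂ ⁻¹' (F \ Z)))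
    (hNs' : ∀ F' ∈ Ns', ∃ F : Set G, (F ∈ Ns ∨ F ∈ H :: Cs) ∧ F' = closure (υ₂ ⁻¹' (F \ Z))) :
    Tower.InvB₄ O k θ P q Y Ch Ruled F₉ Z₉ hZ₉ F₁₀ υ' G' (υ₂ ≫ γ) (closure (υ₂ ⁻¹' (T \ Z))) E' Es' Ns' K' := by
  classical
  have hWc : closure W = W := hW.closure_eq
  have hZeq : Z = H ∩ W := by rw [hpair.1, hWc]
  have hZE : Z ⊆ H := fun z hz => (hZeq ▸ hz : z ∈ H ∩ W).1
  have hZW : Z ⊆ W := fun z hz => (hZeq ▸ hz : z ∈ H ∩ W).2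
  obtain ⟨𝓔, he_i, he_ii, he_iii, he_iv, he_v, hshadow⟩ := hExcH
  obtain ⟨hW', hTW, hExcW⟩ := hCand W hWmem
  obtain ⟨𝓦, hw_i, hw_ii, hw_iii, hw_iv, hw_v, -⟩ := hExcW
  have hw_i' : 𝓦.comap jG = vanishingIdeal ⟨W, hW⟩ := by rw [hw_i]
  obtain ⟨hc1, hc2, hc3, hc4, hc4', hc5⟩ := hPair 𝓔 𝓦 he_i he_ii he_iii he_iv he_v hw_i' hw_ii hw_iii hw_iv hw_v hTW
  obtain ⟨-, -, hσ⟩ := chain_isRegular P Y X σ S (hChain _ _ _ hCh) hPnoeth hPreg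
  haveI := hσ
  haveI : IsProper (σ ≫ q) := inferInstance
  haveI : IsClosedImmersion (Spec.map (CommRingCat.ofHom θ)) := IsClosedImmersion.spec_of_surjective _ hθ
  haveI hjci : IsClosedImmersion jG := MorphismProperty.IsStableUnderBaseChange.of_isPullback hsq.flip inferInstance
  haveI : IsLocallyNoetherian G := LocallyOfFiniteType.isLocallyNoetherian jG
  have hiv : σ '' ((𝓔 ⊔ 𝓦).support : Set X) ⊆ {p : P | ¬ IsGenericPoint p Y} := by
    rintro _ ⟨x, hx, rfl⟩
    exact he_iv ⟨x, Scheme.IdealSheafData.support_antitone le_sup_left hx, rfl⟩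
  have hsuppZ : ((vanishingIdeal ⟨Z, hZ⟩ : G.IdealSheafData).support : Set G) = Z := Scheme.IdealSheafData.coe_support_vanishingIdeal _
  have hDT : ((vanishingIdeal ⟨Z, hZ⟩ : G.IdealSheafData).support : Set G) ⊆ T := by rw [hsuppZ]; exact hZT
  have hTZ : ¬ T ⊆ Z := fun h => hTH (h.trans hZE)
  have hTD : ¬ T ⊆ ((vanishingIdeal ⟨Z, hZ⟩ : G.IdealSheafData).support : Set G) := by rw [hsuppZ]; exact hTZ
  obtain ⟨X₂, τ, hτ⟩ := exists_isBlowup X (𝓔 ⊔ 𝓦)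
  obtain ⟨hint₂, hnoeth₂, hreg₂, hdom₂, hF₂, hirr, j₂, t₂, hsq₂, hcomm, hCh₂⟩ :=
    modelStep_chain O k θ hθ P q Y hYirr hYcl Ch hChain hStep X σ S hCh hXreg hdom G jG tG hsq T hTS (𝓔 ⊔ 𝓦)
      (vanishingIdeal ⟨Z, hZ⟩) hc1 hc3 hc2 hiv hDT hTD X₂ τ hτ G' υ₂ hυ₂
  rw [hsuppZ] at hirr hCh₂
  haveI := hint₂
  haveI := hnoeth₂
  haveI := hF₂
  haveI : IsProper τ := hτ.isProper
  have hcart : IsPullback j₂ υ₂ τ jG := isPullback_of_model_squares θ hθ (σ ≫ q) τ jG tG hsq j₂ t₂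
    (by simpa only [Category.assoc] using hsq₂) υ₂ hcomm
  obtain ⟨t, htT, htE⟩ := Set.not_subset.mp hTH
  have htZ : t ∉ Z := fun h => htE (hZE h)
  obtain ⟨t', ht'⟩ := hυ₂.exists_preimage_of_not_mem_support (z := t) (by rw [hsuppZ]; exact htZ)
  have hTEnew : ¬ closure (υ₂ ⁻¹' (T \ Z)) ⊆ υ₂ ⁻¹' Z := by
    intro h
    have h1 : t' ∈ closure (υ₂ ⁻¹' (T \ Z)) := subset_closure (show υ₂ t' ∈ T \ Z by rw [ht']; exact ⟨htT, htZ⟩)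
    have h2 : υ₂ t' ∈ Z := h h1
    rw [ht'] at h2
    exact htZ h2
  have hCne : 𝓔 ⊔ 𝓦 ≠ ⊥ := by
    rintro hbot
    obtain ⟨u, hu, hKu⟩ := hτ.isEffectiveCartier.exists_stalkIdeal_eq_span (j₂ t')
    rw [hbot, Scheme.IdealSheafData.comap_bot, stalkIdeal_bot, eq_comm, Ideal.span_singleton_eq_bot] at hKu
    rw [hKu] at hu
    exact zero_notMem_nonZeroDivisors hu
  have hCD : ((𝓔 ⊔ 𝓦).support : Set X) ∩ (σ ≫ q) ⁻¹' {closedPoint O} ⊆ jG '' Z := by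
    rintro c ⟨hcC, hcsp⟩
    have hc : c ∈ Set.range jG := by
      rw [range_eq_preimage_of_isPullback hsq, range_specMap_of_surjective_of_field θ hθ]; exact hcsp
    obtain ⟨g, rfl⟩ := hc
    refine ⟨g, ?_, rfl⟩
    have h1 : g ∈ (((𝓔 ⊔ 𝓦).comap jG).support : Set G) := by rw [support_comap]; exact hcC
    rw [hc1, hsuppZ] at h1
    exact h1
  have hqr : ∀ z ∈ ((⟨Z, hZ⟩ : Closeds G) : Set G), ∃ (n : ℕ) (c : Fin n → X.presheaf.stalk (jG z)),
      Ideal.span (Set.range c) = stalkIdeal (𝓔 ⊔ 𝓦) (jG z) ∧ IsQuasiRegular c := by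
    intro z hz
    have hzC : jG z ∈ ((𝓔 ⊔ 𝓦).support : Set X) := by
      have h1 : z ∈ (((𝓔 ⊔ 𝓦).comap jG).support : Set G) := by rw [hc1, hsuppZ]; exact hz
      rw [Scheme.IdealSheafData.support_comap] at h1
      exact h1
    obtain ⟨c, hc, hq⟩ := hc5 (jG z) hzC
    exact ⟨2, c, hc, hq⟩
  have he1 : ((𝓔 ⊔ 𝓦).comap τ).comap j₂ = vanishingIdeal ⟨υ₂ ⁻¹' Z, hZ.preimage υ₂.continuous⟩ :=
    comap_comap_eq_vanishingIdeal_preimage_of_model O k θ hθ (σ ≫ q) jG tG hsq (𝓔 ⊔ 𝓦) τ hτ j₂ t₂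
      (by simpa only [Category.assoc] using hsq₂) υ₂ hcomm ⟨Z, hZ⟩ hc1 hqr
  have he2 : ∀ z : X₂, (stalkIdeal ((𝓔 ⊔ 𝓦).comap τ) z).IsPrincipal := fun z => by
    obtain ⟨u, -, hu⟩ := hτ.isEffectiveCartier.exists_stalkIdeal_eq_span z
    exact ⟨⟨u, by rw [hu, Ideal.submodule_span_eq]⟩⟩
  have he3 : Scheme.IsRegular ((𝓔 ⊔ 𝓦).comap τ).subscheme := hτ.isRegular_subscheme_comap hXreg hc3
  have he4 : (τ ≫ σ) '' (((𝓔 ⊔ 𝓦).comap τ).support : Set X₂) ⊆ {p : P | ¬ IsGenericPoint p Y} := by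
    rintro _ ⟨z, hz, rfl⟩
    rw [Scheme.IdealSheafData.support_comap] at hz
    exact hiv ⟨τ z, hz, rfl⟩
  have he5 : Ruled F₉ Z₉ hZ₉ F₁₀ υ' G' (υ₂ ≫ γ) (υ₂ ⁻¹' Z) X₂ (τ ≫ σ) j₂ ((𝓔 ⊔ 𝓦).comap τ) :=
    hRuledBorn X σ S jG tG 𝓔 𝓦 X₂ τ j₂ t₂ hCh inferInstance inferInstance hXreg hdom hsq hTS hc1 hc2 hc3 he_iii hτ hsq₂ hcomm
  have hk1 : ∀ (𝒦 : X.IdealSheafData), (∀ z : X, (stalkIdeal 𝒦 z).IsPrincipal) →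
      ∀ z : X₂, (stalkIdeal (strictTransformIdeal τ (𝓔 ⊔ 𝓦) 𝒦) z).IsPrincipal := fun 𝒦 h𝒦 z =>
    isPrincipal_stalkIdeal_strictTransformIdeal hXreg hc3 hτ hCne 𝒦 h𝒦 z
  have hExcNew : ∀ hE' : IsClosed (υ₂ ⁻¹' Z),
      Tower.Exc₄ O P q Y Ruled Z₉ hZ₉ υ' G' (υ₂ ≫ γ) (υ₂ ⁻¹' Z) hE' K' X₂ (τ ≫ σ) j₂ := by
    intro hE'
    refine ⟨(𝓔 ⊔ 𝓦).comap τ, he1, he2, he3, he4, he5, ?_⟩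
    rcases hK' with hK0 | ⟨hoff, hKst⟩
    · exact Or.inl hK0
    · subst hKst
      rcases hshadow with hK0 | ⟨𝒦, hk_i, ⟨V, hEV, hk_ii⟩, hk_iii, hk_iv, hk_v, hk_vi⟩
      · left
        subst hK0
        simp only [Set.empty_sdiff, Set.preimage_empty, closure_empty]
      · right
        obtain ⟨hs2, hs3, hs4, hs5, hs6⟩ := hShadow X σ S jG tG 𝓔 𝒦 𝓦 X₂ τ j₂ t₂ hCh inferInstance inferInstance hXreg hdom hsq hTS
          he_i he_ii he_iii hk_i V hEV hk_ii hk_iii hk_v hk_vi hc1 hc2 hc3 hc4 hτ hsq₂ hcomm hKcl hKE hKne hoff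
        exact ⟨_, hk1 𝒦 hk_i, ⟨υ₂ ⁻¹ᵁ V, Set.preimage_mono (hZE.trans hEV), hs2⟩, hs3, hs4 hE', hs5, hs6⟩
  have hTEold : ¬ closure (υ₂ ⁻¹' (T \ Z)) ⊆ closure (υ₂ ⁻¹' (H \ Z)) := by
    intro h
    have h1 : t' ∈ closure (υ₂ ⁻¹' (T \ Z)) := subset_closure (show υ₂ t' ∈ T \ Z by rw [ht']; exact ⟨htT, htZ⟩)
    have h2 : t' ∈ υ₂ ⁻¹' H :=
      (closure_minimal (Set.preimage_mono fun x hx => hx.1) (hH.preimage υ₂.continuous)) (h h1)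
    rw [Set.mem_preimage, ht'] at h2
    exact htE h2
  have hEZ : H ⊆ closure (H \ Z) :=
    subset_closure_diff_of_flat_of_isEffectiveCartier θ hθ q σ jG tG hsq 𝓔 𝓦 hH hZ he_i hc1 hc2 hc4
  have hEc : ((⟨H, hH⟩ : Closeds G) : Set G) ⊆ closure (((⟨H, hH⟩ : Closeds G) : Set G) \ (⟨Z, hZ⟩ : Closeds G)) := hEZ
  have ho1 : (strictTransformIdeal τ (𝓔 ⊔ 𝓦) 𝓔).comap j₂ =
      vanishingIdeal (⟨closure (υ₂ ⁻¹' (H \ Z)), isClosed_closure⟩ : Closeds G') :=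
    coneRound_exceptional_comap 𝓔 𝓦 hc4 hτ hcart ⟨H, hH⟩ ⟨Z, hZ⟩ he_i hυ₂ hEc
  have ho2 : ∀ z : X₂, (stalkIdeal (strictTransformIdeal τ (𝓔 ⊔ 𝓦) 𝓔) z).IsPrincipal := fun z =>
    isPrincipal_stalkIdeal_strictTransformIdeal hXreg hc3 hτ hCne 𝓔 he_ii z
  obtain ⟨e𝓔, he𝓔⟩ := exists_iso_subscheme_strictTransformIdeal_exceptional 𝓔 𝓦 hc4 hτ
  have ho3 : Scheme.IsRegular (strictTransformIdeal τ (𝓔 ⊔ 𝓦) 𝓔).subscheme :=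
    Scheme.IsRegular.of_isOpenImmersion e𝓔.hom he_iii
  have ho4 : (τ ≫ σ) '' ((strictTransformIdeal τ (𝓔 ⊔ 𝓦) 𝓔).support : Set X₂) ⊆ {p : P | ¬ IsGenericPoint p Y} := by
    rintro _ ⟨z, hz, rfl⟩
    have hz' : z ∈ ((𝓔.comap τ).support : Set X₂) :=
      Scheme.IdealSheafData.support_antitone (comap_le_strictTransformIdeal τ (𝓔 ⊔ 𝓦) 𝓔) hz
    rw [Scheme.IdealSheafData.support_comap] at hz'
    exact he_iv ⟨τ z, hz', rfl⟩
  have ho5 : Ruled F₉ Z₉ hZ₉ F₁₀ υ' G' (υ₂ ≫ γ) (closure (υ₂ ⁻¹' (H \ Z))) X₂ (τ ≫ σ) j₂ (strictTransformIdeal τ (𝓔 ⊔ 𝓦) 𝓔) :=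
    hRuledIso G G' γ _ H _ X X₂ σ jG j₂ 𝓔 _ τ ⟨e𝓔, he𝓔⟩ he_v
  have hExcOld : ∀ hE' : IsClosed (closure (υ₂ ⁻¹' (H \ Z))),
      Tower.Exc₄ O P q Y Ruled Z₉ hZ₉ υ' G' (υ₂ ≫ γ) (closure (υ₂ ⁻¹' (H \ Z))) hE' K' X₂ (τ ≫ σ) j₂ := by
    intro hE'
    refine ⟨strictTransformIdeal τ (𝓔 ⊔ 𝓦) 𝓔, ho1, ho2, ho3, ho4, ho5, ?_⟩
    rcases hK' with hK0 | ⟨hoff, hKst⟩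
    · exact Or.inl hK0
    · subst hKst
      rcases hshadow with hK0 | ⟨𝒦, hk_i, ⟨V, hEV, hk_ii⟩, hk_iii, hk_iv, hk_v, hk_vi⟩
      · left
        subst hK0
        simp only [Set.empty_sdiff, Set.preimage_empty, closure_empty]
      · right
        obtain ⟨hs2, hs3, hs4, hs5, hs6⟩ := hShadowOld X σ S jG tG 𝓔 𝒦 𝓦 X₂ τ j₂ t₂ hCh inferInstance inferInstance hXreg hdom hsq hTS
          he_i he_ii he_iii hk_i V hEV hk_ii hk_iii hk_iv hk_v hk_vi hc1 hc2 hc3 hc4 hτ hsq₂ hcomm hKcl hKE hKne hoff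
        exact ⟨_, hk1 𝒦 hk_i, ⟨υ₂ ⁻¹ᵁ V,
          (closure_minimal (Set.preimage_mono fun x hx => hx.1) (hH.preimage υ₂.continuous)).trans (Set.preimage_mono hEV), hs2⟩,
          hs3, hs4 hE', hs5, hs6⟩
  have hExcOld₀ : ∀ hE' : IsClosed (closure (υ₂ ⁻¹' (H \ Z))),
      Tower.Exc₄ O P q Y Ruled Z₉ hZ₉ υ' G' (υ₂ ≫ γ) (closure (υ₂ ⁻¹' (H \ Z))) hE' ∅ X₂ (τ ≫ σ) j₂ :=
    fun hE' => Tower.exc₄_forgetShadow O P q Y Ruled (hExcOld hE')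
  have hWE : 𝓦 ⊔ 𝓔 = 𝓔 ⊔ 𝓦 := sup_comm _ _
  have hτ' : IsBlowup τ (𝓦 ⊔ 𝓔) := by rw [hWE]; exact hτ
  have hc1' : (𝓦 ⊔ 𝓔).comap jG = vanishingIdeal ⟨Z, hZ⟩ := by rw [hWE]; exact hc1
  have hc2' : Flat ((𝓦 ⊔ 𝓔).subschemeι ≫ σ ≫ q) := by rw [hWE]; exact hc2
  have hWZ : W ⊆ closure (W \ Z) :=
    subset_closure_diff_of_flat_of_isEffectiveCartier θ hθ q σ jG tG hsq 𝓦 𝓔 hW hZ hw_i' hc1' hc2' hc4'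
  have hWc' : ((⟨W, hW⟩ : Closeds G) : Set G) ⊆ closure (((⟨W, hW⟩ : Closeds G) : Set G) \ (⟨Z, hZ⟩ : Closeds G)) := hWZ
  have hSt : strictTransformIdeal τ (𝓦 ⊔ 𝓔) 𝓦 = strictTransformIdeal τ (𝓔 ⊔ 𝓦) 𝓦 := by rw [hWE]
  have hw1 : (strictTransformIdeal τ (𝓔 ⊔ 𝓦) 𝓦).comap j₂ =
      vanishingIdeal (⟨closure (υ₂ ⁻¹' (W \ Z)), isClosed_closure⟩ : Closeds G') := by
    rw [← hSt]; exact coneRound_exceptional_comap 𝓦 𝓔 hc4' hτ' hcart ⟨W, hW⟩ ⟨Z, hZ⟩ hw_i' hυ₂ hWc'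
  have hw2 : ∀ z : X₂, (stalkIdeal (strictTransformIdeal τ (𝓔 ⊔ 𝓦) 𝓦) z).IsPrincipal := fun z =>
    isPrincipal_stalkIdeal_strictTransformIdeal hXreg hc3 hτ hCne 𝓦 hw_ii z
  obtain ⟨e𝓦, he𝓦⟩ : ∃ e : (strictTransformIdeal τ (𝓔 ⊔ 𝓦) 𝓦).subscheme ≅ 𝓦.subscheme,
      e.hom ≫ 𝓦.subschemeι = (strictTransformIdeal τ (𝓔 ⊔ 𝓦) 𝓦).subschemeι ≫ τ := by
    rw [← hSt]; exact exists_iso_subscheme_strictTransformIdeal_exceptional 𝓦 𝓔 hc4' hτ'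
  have hw3 : Scheme.IsRegular (strictTransformIdeal τ (𝓔 ⊔ 𝓦) 𝓦).subscheme :=
    Scheme.IsRegular.of_isOpenImmersion e𝓦.hom hw_iii
  have hw4 : (τ ≫ σ) '' ((strictTransformIdeal τ (𝓔 ⊔ 𝓦) 𝓦).support : Set X₂) ⊆ {p : P | ¬ IsGenericPoint p Y} := by
    rintro _ ⟨z, hz, rfl⟩
    have hz' : z ∈ ((𝓦.comap τ).support : Set X₂) :=
      Scheme.IdealSheafData.support_antitone (comap_le_strictTransformIdeal τ (𝓔 ⊔ 𝓦) 𝓦) hz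
    rw [Scheme.IdealSheafData.support_comap] at hz'
    exact hw_iv ⟨τ z, hz', rfl⟩
  have hw5 : Ruled F₉ Z₉ hZ₉ F₁₀ υ' G' (υ₂ ≫ γ) (closure (υ₂ ⁻¹' (W \ Z))) X₂ (τ ≫ σ) j₂ (strictTransformIdeal τ (𝓔 ⊔ 𝓦) 𝓦) :=
    hRuledIso G G' γ _ W _ X X₂ σ jG j₂ 𝓦 _ τ ⟨e𝓦, he𝓦⟩ hw_v
  have hExcCo : ∀ hW'' : IsClosed (closure (υ₂ ⁻¹' (W \ Z))),
      Tower.Exc₄ O P q Y Ruled Z₉ hZ₉ υ' G' (υ₂ ≫ γ) (closure (υ₂ ⁻¹' (W \ Z))) hW'' ∅ X₂ (τ ≫ σ) j₂ := fun hW'' =>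
    ⟨strictTransformIdeal τ (𝓔 ⊔ 𝓦) 𝓦, hw1, hw2, hw3, hw4, hw5, Or.inl rfl⟩
  have hRuledAway : ∀ (F : Set G) (𝓕 : X.IdealSheafData),
      (∃ e : (𝓕.comap τ).subscheme ≅ 𝓕.subscheme, e.hom ≫ 𝓕.subschemeι = (𝓕.comap τ).subschemeι ≫ τ) →
      Ruled F₉ Z₉ hZ₉ F₁₀ υ' G γ F X σ jG 𝓕 →
      Ruled F₉ Z₉ hZ₉ F₁₀ υ' G' (υ₂ ≫ γ) (closure (υ₂ ⁻¹' (F \ Z))) X₂ (τ ≫ σ) j₂ (𝓕.comap τ) :=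
    fun F 𝓕 he hR => hRuledIso G G' γ _ F _ X X₂ σ jG j₂ 𝓕 _ τ he hR
  have hEs'B : ∀ F' ∈ Es', IsClosed F' ∧ ¬ closure (υ₂ ⁻¹' (T \ Z)) ⊆ F' := by
    intro F' hF'
    obtain ⟨F, hFmem, ⟨hrule, rfl⟩⟩ := hEs' F' hF'
    obtain ⟨hF, hTF, -⟩ := hCand F hFmem
    exact ⟨isClosed_closure, not_closure_preimage_diff_subset hυ₂ hTirr hF hZ hTF hTZ hsuppZ.le⟩
  have hEs'Exc : ∀ F' ∈ Es', ∀ hF' : IsClosed F',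
      Tower.Exc₄ O P q Y Ruled Z₉ hZ₉ υ' G' (υ₂ ≫ γ) F' hF' ∅ X₂ (τ ≫ σ) j₂ := by
    intro F' hF'
    obtain ⟨F, hFmem, ⟨hrule, rfl⟩⟩ := hEs' F' hF'
    rcases hrule with rfl | hFW | hdisjZF | hX3
    · exact hExcOld₀ -- the host: its strict transform, shadow forgotten
    · subst hFW; exact hExcCo -- the witness: the CO-HOST transport (ii′)
    · -- a member away from the centre: B-AWAY
      obtain ⟨hF, -, hExcF0⟩ := hCand F hFmem
      exact Tower.exc₄_transport_away O P q Y Ruled hτ hυ₂ hsuppZ hcomm hRuledAway hF hExcF0 hdisjZF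
        (fun 𝓕 h𝓕 => disjoint_support_centre_of_trace (σ ≫ q) (𝓔 ⊔ 𝓦) 𝓕 hF hCD h𝓕 hdisjZF)
    · -- a member CROSSED by the centre: B-TRACE (T23-A′), dischargers from `hSNC` / `hTrace`
      obtain ⟨hF, hTF, hExcF0⟩ := hCand F hFmem
      have hRuledSt' : ∀ (F₀ : Set G) (F₀' : Set G') (𝓕 : X.IdealSheafData), Ruled F₉ Z₉ hZ₉ F₁₀ υ' G γ F₀ X σ jG 𝓕 →
          Ruled F₉ Z₉ hZ₉ F₁₀ υ' G' (υ₂ ≫ γ) F₀' X₂ (τ ≫ σ) j₂ (strictTransformIdeal τ (𝓔 ⊔ 𝓦) 𝓕) :=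
        fun F₀ F₀' 𝓕 hR => hRuledSt G G' γ _ F₀ F₀' X X₂ σ jG j₂ 𝓕 _ τ hτ inferInstance inferInstance hR
      exact Tower.exc₄_transport_transversal' O P q Y Ruled hτ hXreg hc3 hCne hRuledSt' hF hExcF0
        (fun 𝓕 h1 h2 h3 h4 h5 => hSNC (𝓔 ⊔ 𝓦) 𝓕 F hF hX3 inferInstance hc1 hc2 hc3 h1 h2 h3 h4 h5 hTF)
        (fun 𝓕 h1 h2 h3 h4 h5 hE => hTrace (𝓔 ⊔ 𝓦) 𝓕 F hF X₂ τ j₂ t₂ hX3 inferInstance hc1 hc2 hc3 hτ inferInstance hsq₂ hcomm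
          h1 h2 h3 h4 h5 hTF hE)
  have hNs'B : ∀ F' ∈ Ns', IsClosed F' ∧ ¬ closure (υ₂ ⁻¹' (T \ Z)) ⊆ F' := by
    intro F' hF'
    obtain ⟨F, hFmem, rfl⟩ := hNs' F' hF'
    have hFB : IsClosed F ∧ ¬ T ⊆ F := by
      rcases hFmem with hN | hC
      · exact hNs F hN
      · rcases List.mem_cons.mp hC with rfl | hC
        · exact ⟨hH, hTH⟩
        · obtain ⟨hF, hTF, -⟩ := hCand F hC
          exact ⟨hF, hTF⟩
    exact Tower.ns_transport_of_closed hυ₂ hTirr hZ hTZ hsuppZ.le hFB.1 hFB.2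
  rcases hE' with rfl | rfl
  · exact ⟨hυ', hZinf, hF₂, isClosed_closure, hirr, hZ.preimage υ₂.continuous, hTEnew, hEs'B, hNs'B, X₂, τ ≫ σ, _, j₂, t₂, hCh₂, hint₂,
      hnoeth₂, hreg₂, hdom₂, hsq₂, rfl, hExcNew, hEs'Exc⟩
  · exact ⟨hυ', hZinf, hF₂, isClosed_closure, hirr, isClosed_closure, hTEold, hEs'B, hNs'B, X₂, τ ≫ σ, _, j₂, t₂, hCh₂, hint₂,
      hnoeth₂, hreg₂, hdom₂, hsq₂, rfl, hExcOld, hEs'Exc⟩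

end Summit.ResolutionOfSingularities.ResolutionOfSingularities.Cruxes.EquisingularLiftNat.Sections

end
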